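import Mathlib
import Summits.PneNP.PneNP.Theorems.PstarFibreCNF
import Literature.Computability.MetaComplexity.ResLinProverDelayer

/-!
# Parity decision trees are Provers: Delayer coins bound PDT size (ROUND-24 item T24.3a, wiring)

FRONTIER range-avoidance ladder, ROUND-24 item T24.3a (cell `pnp-ideate`, planner seat p3's pre-seed §7(b); restricted-model
proof complexity — nothing here bears on `P` versus `NP`).

The tree's Prover–Delayer library (`Literature.Computability.MetaComplexity.ResLinProverDelayer`: boards of `𝔽₂`-equations,
Delayer `Strategy`, `Conform`, `coins`, `Contradicts`, `Guarantees φ δ t`) measures tree-like `Res(⊕)` refutations of a CNF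
`φ` over `ℕ`-indexed variables.  A parity decision tree `T : PstarPDT.PDT n m` solving the falsified-output search problem of
the fibre `I(z) = y` (`T.Solves I y`) is a PROVER on `φ = PstarFibreCNF.fibreCNF I y`: walk down `T` asking the query parities
(`formOf S = S.map Fin.val`), follow Delayer's answer, take the SMALLER subtree when Delayer answers `*` (each coin halves the
number of leaves ahead), and at the leaf `j` pin the `k` variables of output `j` singly (at most `k` further coins); the board
then contradicts the pattern clause of `j`.  Hence

* `coins_le_of_solves` (the play): from any conforming board on whose solution set `T` solves the search problem, Prover ends
  the game conceding at most `log₂ (T.size) + k` more coins;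
* **`two_pow_le_size_of_guarantees`**: `Guarantees (fibreCNF I y) δ t → T.Solves I y → 2^t ≤ 2^k · T.size`, and
  `le_depth_of_guarantees`: `t ≤ T.depth + k`.

So a Delayer strategy with `t = n/c` coins on the fibre CNF — the library-native form of the ROUND-24 research statement —
gives at once tree-like `Res(⊕)` size `≥ 2^{n/c}` (`ProverDelayer.two_pow_le_length_of_guarantees`) and PDT size
`≥ 2^{n/c − k}`, depth `≥ n/c − k` for every solving parity decision tree.
-/

set_option linter.dupNamespace false -- `Summit.PneNP.PneNP.…`: summit = sub-problem name (D-0017 single-conjunct layout)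

open Finset Literature.Computability.Complexity Literature.Computability.MetaComplexity
open Literature.Computability.MetaComplexity.ProverDelayer
open Summit.PneNP.PneNP.Theorems.PstarPDT (PDT parity)
open Summit.PneNP.PneNP.Theorems.PstarFibreCNF (fibreCNF patternClause outputClauses eval_patternClause_iff
  satisfiable_fibreCNF_iff)

namespace Summit.PneNP.PneNP.Theorems.PstarPDTResLin

variable {k n m : ℕ}

/-! ## Queries as linear forms over `ℕ` -/

/-- The query set `S ⊆ Fin n` as a linear form on `ℕ`-indexed variables. -/
def formOf (S : Finset (Fin n)) : Finset ℕ := S.map Fin.valEmbedding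

/-- The board equation `formOf S = a` holds under `σ` iff the parity of `S` on the input `σ ∘ val` is `a`. -/
theorem eval_formOf (σ : ℕ → Bool) (S : Finset (Fin n)) (a : Bool) :
    LinLit.eval σ (formOf S, a) = true ↔ parity S (fun v => σ v.val) = a := by
  have hc : ((formOf S).filter fun i => σ i = true).card = (S.filter fun v => σ v.val = true).card := by
    unfold formOf
    rw [Finset.filter_map, Finset.card_map]
    rfl
  unfold LinLit.eval PstarPDT.parity
  rw [decide_eq_true_eq, hc]
  cases a
  · simp only [Bool.toNat_false, decide_eq_false_iff_not, Nat.not_odd_iff_even, Nat.even_iff]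
  · simp only [Bool.toNat_true, decide_eq_true_eq, Nat.odd_iff]

/-- `σ` satisfies every equation of the board. -/
def Holds (Φ : List LinLit) (σ : ℕ → Bool) : Prop := ∀ e ∈ Φ, LinLit.eval σ e = true

/-! ## The pinning phase at a leaf -/

/-- Ask the variables of a list singly, writing Delayer's answer (or `false` when he answers `*`). -/
def pin (δ : Strategy) : List ℕ → List LinLit → List LinLit
  | [], Φ => Φ
  | v :: vs, Φ => pin δ vs ((({v} : Finset ℕ), (δ Φ {v}).getD false) :: Φ)

/-- Pinning keeps the board conforming. -/
theorem conform_pin (δ : Strategy) : ∀ (vs : List ℕ) (Φ : List LinLit), Conform δ Φ → Conform δ (pin δ vs Φ) := by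
  intro vs
  induction vs with
  | nil => intro Φ h; exact h
  | cons v vs ih =>
    intro Φ h
    refine ih _ ⟨h, ?_⟩
    rcases hδ : δ Φ {v} with _ | a
    · exact Or.inl rfl
    · exact Or.inr (by simp)

/-- Pinning `vs` concedes at most `|vs|` coins. -/
theorem coins_pin_le (δ : Strategy) : ∀ (vs : List ℕ) (Φ : List LinLit), coins δ (pin δ vs Φ) ≤ coins δ Φ + vs.length := by
  intro vs
  induction vs with
  | nil => intro Φ; simp [pin]
  | cons v vs ih =>
    intro Φ
    refine (ih _).trans ?_
    simp only [coins_cons, List.length_cons]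
    split_ifs <;> omega

/-- The old equations stay on the board. -/
theorem holds_of_holds_pin (δ : Strategy) : ∀ (vs : List ℕ) (Φ : List LinLit) (σ : ℕ → Bool),
    Holds (pin δ vs Φ) σ → Holds Φ σ := by
  intro vs
  induction vs with
  | nil => intro Φ σ h; exact h
  | cons v vs ih =>
    intro Φ σ h
    have h' := ih _ σ h
    exact fun e he => h' e (List.mem_cons_of_mem _ he)

/-- After pinning, all solutions of the board agree on the pinned variables. -/
theorem eq_of_holds_pin (δ : Strategy) : ∀ (vs : List ℕ) (Φ : List LinLit) (σ σ' : ℕ → Bool),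
    Holds (pin δ vs Φ) σ → Holds (pin δ vs Φ) σ' → ∀ v ∈ vs, σ v = σ' v := by
  intro vs
  induction vs with
  | nil => intro Φ σ σ' _ _ v hv; simp at hv
  | cons v vs ih =>
    intro Φ σ σ' h h' w hw
    rcases List.mem_cons.1 hw with rfl | hw
    · have h1 := holds_of_holds_pin δ vs _ σ h _ List.mem_cons_self
      have h2 := holds_of_holds_pin δ vs _ σ' h' _ List.mem_cons_self
      rw [LinLit.eval_singleton, beq_iff_eq] at h1 h2
      rw [h1, h2]
    · exact ih _ σ σ' h h' w hw

/-! ## The play down the tree -/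

/-- The pattern clause of a falsifying pattern is a clause of the fibre CNF. -/
theorem patternClause_mem (I : LocalMap k n m) (y : Fin m → Bool) {j : Fin m} {u : Fin k → Bool}
    (hu : I.table j u ≠ y j) : patternClause I j u ∈ fibreCNF I y := by
  unfold PstarFibreCNF.fibreCNF
  rw [List.mem_flatMap]
  refine ⟨j, List.mem_finRange j, ?_⟩
  unfold PstarFibreCNF.outputClauses
  rw [List.mem_map]
  refine ⟨u, ?_, rfl⟩
  rw [List.mem_filter, Finset.mem_toList]
  exact ⟨Finset.mem_univ _, by simpa using hu⟩

/-- A solved target has a nonempty fibre CNF. -/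
theorem fibreCNF_ne_nil (I : LocalMap k n m) {y : Fin m → Bool} {T : PDT n m} (hT : T.Solves I y) :
    ∃ c, c ∈ fibreCNF I y := by
  have hy := PstarPDT.not_mem_range_of_solves hT
  rw [← satisfiable_fibreCNF_iff] at hy
  by_contra hne
  push Not at hne
  have hnil : fibreCNF I y = [] := List.eq_nil_iff_forall_not_mem.2 hne
  exact hy ⟨fun _ => false, by rw [hnil]; rfl⟩

/-- **The play.**  If a conforming board `Φ` is such that `T` solves the search problem on every solution of `Φ`, Prover can end
the game from `Φ` conceding at most `log₂ (T.size) + k` further coins. -/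
theorem coins_le_of_solves (δ : Strategy) (I : LocalMap k n m) (y : Fin m → Bool) (hne : ∃ c, c ∈ fibreCNF I y) :
    ∀ (T : PDT n m) (Φ : List LinLit), Conform δ Φ →
      (∀ σ, Holds Φ σ → I.eval (fun v => σ v.val) (T.run fun v => σ v.val) ≠ y (T.run fun v => σ v.val)) →
      ∃ Φ', Conform δ Φ' ∧ (∃ c ∈ fibreCNF I y, Contradicts Φ' (Clause.toLinClause c)) ∧
        coins δ Φ' ≤ coins δ Φ + Nat.log 2 T.size + k := by
  intro T
  induction T with
  | leaf j =>
    intro Φ hconf hsol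
    set vs := List.ofFn fun i : Fin k => (I.vars j i).val with hvs
    refine ⟨pin δ vs Φ, conform_pin δ vs Φ hconf, ?_, ?_⟩
    · by_cases hsat : ∃ σ, Holds (pin δ vs Φ) σ
      · obtain ⟨σ₀, hσ₀⟩ := hsat
        set u : Fin k → Bool := fun i => σ₀ (I.vars j i).val with hu
        have hfals : I.table j u ≠ y j := hsol σ₀ (holds_of_holds_pin δ vs Φ σ₀ hσ₀)
        refine ⟨patternClause I j u, patternClause_mem I y hfals, fun σ hσ => ?_⟩
        rw [eval_toLinClause]
        have hpat : (fun i => σ (I.vars j i).val) = u := by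
          funext i
          exact eq_of_holds_pin δ vs Φ σ σ₀ hσ hσ₀ _ (by rw [hvs, List.mem_ofFn]; exact ⟨i, rfl⟩)
        have := (eval_patternClause_iff I j u σ).not.2 (not_not.2 hpat)
        revert this
        unfold Clause.eval
        cases (patternClause I j u).any (Literal.eval σ) <;> simp
      · obtain ⟨c, hc⟩ := hne
        refine ⟨c, hc, fun σ hσ => ?_⟩
        exact absurd ⟨σ, hσ⟩ hsat
    · have h := coins_pin_le δ vs Φ
      rw [hvs, List.length_ofFn] at h
      simp only [PDT.size, Nat.log_one_right, add_zero]
      exact h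
  | node S t₀ t₁ ih₀ ih₁ =>
    intro Φ hconf hsol
    -- the move to a subtree after the answer `a`
    have move : ∀ a : Bool, Conform δ ((formOf S, a) :: Φ) →
        ∃ Φ', Conform δ Φ' ∧ (∃ c ∈ fibreCNF I y, Contradicts Φ' (Clause.toLinClause c)) ∧
          coins δ Φ' ≤ coins δ ((formOf S, a) :: Φ) + Nat.log 2 (if a then t₁ else t₀).size + k := by
      intro a hconf₁
      have hsol₁ : ∀ σ, Holds ((formOf S, a) :: Φ) σ →
          I.eval (fun v => σ v.val) ((if a then t₁ else t₀).run fun v => σ v.val) ≠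
            y ((if a then t₁ else t₀).run fun v => σ v.val) := by
        intro σ hσ
        have hpar : parity S (fun v => σ v.val) = a := (eval_formOf σ S a).1 (hσ _ List.mem_cons_self)
        have h := hsol σ (fun e he => hσ e (List.mem_cons_of_mem _ he))
        simp only [PDT.run, hpar] at h
        cases a <;> simpa using h
      cases a
      · exact ih₀ _ hconf₁ (by simpa using hsol₁)
      · exact ih₁ _ hconf₁ (by simpa using hsol₁)
    have hlog₀ : Nat.log 2 t₀.size ≤ Nat.log 2 (PDT.node S t₀ t₁).size :=
      Nat.log_mono_right (by simp [PDT.size])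
    have hlog₁ : Nat.log 2 t₁.size ≤ Nat.log 2 (PDT.node S t₀ t₁).size :=
      Nat.log_mono_right (by simp [PDT.size])
    rcases hδ : δ Φ (formOf S) with _ | a
    · -- `*`: go to the smaller subtree
      by_cases hle : t₁.size ≤ t₀.size
      · obtain ⟨Φ', h1, h2, h3⟩ := move true ⟨hconf, Or.inl hδ⟩
        refine ⟨Φ', h1, h2, ?_⟩
        have hlog : Nat.log 2 t₁.size + 1 ≤ Nat.log 2 (PDT.node S t₀ t₁).size := by
          rw [← Nat.log_mul_base (by norm_num) (by have := t₁.one_le_size; omega)]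
          exact Nat.log_mono_right (by simp [PDT.size]; omega)
        simp only [coins_cons, hδ, if_true] at h3
        omega
      · obtain ⟨Φ', h1, h2, h3⟩ := move false ⟨hconf, Or.inl hδ⟩
        refine ⟨Φ', h1, h2, ?_⟩
        have hlog : Nat.log 2 t₀.size + 1 ≤ Nat.log 2 (PDT.node S t₀ t₁).size := by
          rw [← Nat.log_mul_base (by norm_num) (by have := t₀.one_le_size; omega)]
          exact Nat.log_mono_right (by simp [PDT.size]; omega)
        simp only [coins_cons, hδ, if_true] at h3
        have : Nat.log 2 (if false then t₁ else t₀).size = Nat.log 2 t₀.size := rfl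
        omega
    · -- Delayer answers `a`: follow it
      obtain ⟨Φ', h1, h2, h3⟩ := move a ⟨hconf, Or.inr (by rw [hδ])⟩
      refine ⟨Φ', h1, h2, ?_⟩
      simp only [coins_cons, hδ] at h3
      cases a <;> simp at h3 <;> omega

/-- **T24.3a — coins bound PDT size.**  If Delayer guarantees `t` coins on the fibre CNF of `I(z) = y`, every parity decision
tree solving `Search(I, y)` has at least `2^{t−k}` leaves: `2^t ≤ 2^k · T.size`. -/
theorem two_pow_le_size_of_guarantees {I : LocalMap k n m} {y : Fin m → Bool} {δ : Strategy} {t : ℕ}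
    (hδ : Guarantees (fibreCNF I y) δ t) {T : PDT n m} (hT : T.Solves I y) : 2 ^ t ≤ 2 ^ k * T.size := by
  obtain ⟨Φ', hconf, hend, hcoins⟩ := coins_le_of_solves δ I y (fibreCNF_ne_nil I hT) T [] conform_nil
    (fun σ _ => hT _)
  have ht : t ≤ Nat.log 2 T.size + k := by
    have := hδ Φ' hconf hend
    simp only [coins_nil, zero_add] at hcoins
    omega
  calc 2 ^ t ≤ 2 ^ (Nat.log 2 T.size + k) := Nat.pow_le_pow_right (by norm_num) ht
    _ = 2 ^ k * 2 ^ Nat.log 2 T.size := by rw [pow_add, mul_comm]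
    _ ≤ 2 ^ k * T.size := Nat.mul_le_mul_left _ (Nat.pow_log_le_self 2 (by have := T.one_le_size; omega))

/-- … and depth at least `t − k`. -/
theorem le_depth_of_guarantees {I : LocalMap k n m} {y : Fin m → Bool} {δ : Strategy} {t : ℕ}
    (hδ : Guarantees (fibreCNF I y) δ t) {T : PDT n m} (hT : T.Solves I y) : t ≤ T.depth + k := by
  have h1 := two_pow_le_size_of_guarantees hδ hT
  have h2 := T.size_le_two_pow_depth
  have h3 : 2 ^ t ≤ 2 ^ (T.depth + k) := by
    calc 2 ^ t ≤ 2 ^ k * T.size := h1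
      _ ≤ 2 ^ k * 2 ^ T.depth := Nat.mul_le_mul_left _ h2
      _ = 2 ^ (T.depth + k) := by rw [pow_add, mul_comm]
  exact (Nat.pow_le_pow_iff_right (by norm_num)).1 h3

end Summit.PneNP.PneNP.Theorems.PstarPDTResLin
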